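import Summits.HodgeConjecture.HodgeConjecture.Theorems.HCCMUnconditionalH21OfFacts
import Literature.NumberTheory.ComplexMultiplication.CMDefinedOverQbarHolds
import HarnessLib

/-!
# `HCCMUnconditional.H21` from `shimura1998_thm18_6` alone (plus the three reduction-theory records) — rows II-2β / II-2
# discharged by name in A-p01's closing-file head (item stmt-HodgeConjecture-24834, binder `h21` → `Hyp21`)

Topic: summit `HodgeConjecture`, sub-problem `HodgeConjecture`, route `HCCMUnconditional`, crux `H21`
(= `PrintedCitationHypotheses.Hyp21 := shimura1998_thm21_4_casselman`, by `rfl`).  PROVER FILE (cell hodgecm-mathlib, D-0151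
release track; seat A-p10 on director g2's batch 21 (b); `--supports stmt-HodgeConjecture-24834`): sorry-free, axioms ⊆ trio,
THEOREMS ONLY, every proof a one-line composition BY NAME.

WHAT IS HERE.  A-p01's `HCCMUnconditionalH21OfFacts` (p606889) proves
`H21_of_facts (h186 : shimura1998_thm18_6) (h26 : shimura1998_prop26_definedOverNumberField) (hST : shimuraTaniyama_heckeCharacters)`
and `H21_of_thm18_6 (h186) (hQbar : shimura1998_prop26_definedOverQbar) (h₁ h₂ h₃)`.  Row II-2β (`shimura1998_prop26_definedOverQbar`)
and row II-2 (`shimura1998_prop26_definedOverNumberField`) are now THEOREMS of the tree — A-p14's `CMDefinedOverQbarHolds` (p608173: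
`shimura1998_prop26_definedOverQbar_holds`, `shimura1998_prop26_definedOverNumberField_holds`; Shimura 1998 §12.4 Prop. 26 by spreading
out, specialising at a `ℚ̄`-point and reading the CM type on the conormal module of the unit section, then EGA IV₃ 8.8.2 descent to a
number field).  Feeding them in:
* `H21_of_facts'  (h186) (hST)` — `H21` modulo rows II-1 and II-5 only;
* **`H21_of_thm18_6_of_records (h186) (h₁ h₂ h₃)`** — `H21` modulo row II-1 (`shimura1998_thm18_6`, the Main Theorem of Complex
  Multiplication, fan-B line `b2_main_theorem_cm`) and the three reduction-theory RECORDS of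
  `Motives/AbelianVarietyGoodReductionFrobenius` at every finite place of every number field (Néron-model datum
  `nonempty_goodReductionAt`, `ℓ`-adic specialisation datum `nonempty_tateSpecialisation`, converse Néron–Ogg–Šafarevič
  `hasGoodReductionAt_of_isUnramifiedAt`), binders verbatim from `H21_of_thm18_6`;
* the Literature-shaped twins `thm21_4_casselman_of_thm18_6'` / `thm21_4_casselman_of_thm18_6_of_records` concluding the named
  `Prop` `shimura1998_thm21_4_casselman` itself (same terms; for consumers that do not import the route's Theses file).
So the binder `h21` of `hc_cm_of_printed_citations_muKey_ident_lemD3_delRecConjOmegaT` is a kernel theorem from {II-1, VI-NOS ×3}.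
HC_CM is proved only modulo the 7 printed citations until rung 0 closes; this file discharges no binder by itself.

## References
* [Shimura1998] G. Shimura, *Abelian Varieties with Complex Multiplication and Modular Functions*, Princeton Univ. Press (1998):
  §21.4 Thm. 21.4 (p. 192); §18.6 Thm. 18.6; §12.4 Prop. 26 (p. 109); Prop. 19.10, Thm. 19.11.
* [SerreTate1968] J.-P. Serre, J. Tate, *Good reduction of abelian varieties*, Ann. of Math. 88 (1968), §1 Thm. 1, §7 Thm. 10–12.
* [MilneCM2006] J. S. Milne, *Complex Multiplication* (2006), Prop. 7.10.
-/

set_option autoImplicit false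

open IsDedekindDomain
open NumberField hiding ideleGroup
open scoped NumberField

namespace Summit.HodgeConjecture.CorCM.Hyp21

open Literature.AlgebraicGeometry.Motives
open Literature.NumberTheory.ComplexMultiplication

/-- **Shimura 1998 Thm. 21.4 (Casselman), named-`Prop` form, modulo rows II-1 and II-5 only**: `shimura1998_thm21_4_casselman` from
`shimura1998_thm18_6` and `shimuraTaniyama_heckeCharacters`, row II-2 (`shimura1998_prop26_definedOverNumberField`) being fed by A-p14's
theorem `shimura1998_prop26_definedOverNumberField_holds` (p608173).  Term: A-p01's `thm21_4_casselman_of_facts`.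
[cite: Shimura1998, §21.4 Thm. 21.4 (proof, p. 192); §12.4 Prop. 26] -/
theorem thm21_4_casselman_of_thm18_6' (h186 : shimura1998_thm18_6) (hST : shimuraTaniyama_heckeCharacters) :
    shimura1998_thm21_4_casselman :=
  thm21_4_casselman_of_facts h186 shimura1998_prop26_definedOverNumberField_holds hST

/-- **`HCCMUnconditional.H21` modulo rows II-1 and II-5 only** — A-p01's closing-file head `H21_of_facts` with its hypothesis
`h26 : shimura1998_prop26_definedOverNumberField` DISCHARGED by name (`shimura1998_prop26_definedOverNumberField_holds`, A-p14 p608173).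
HC_CM is proved only modulo the 7 printed citations until rung 0 closes. [cite: Shimura1998, §21.4 Thm. 21.4; §12.4 Prop. 26] -/
theorem H21_of_facts' (h186 : shimura1998_thm18_6) (hST : shimuraTaniyama_heckeCharacters) :
    Summit.HodgeConjecture.HodgeConjecture.Theses.HCCMUnconditional.H21 :=
  H21_of_facts h186 shimura1998_prop26_definedOverNumberField_holds hST

/-- **Shimura 1998 Thm. 21.4 (Casselman), named-`Prop` form, from the Main Theorem of CM and the three reduction-theory records**:
`shimura1998_thm21_4_casselman` from `shimura1998_thm18_6` (row II-1) and, at every finite place of every number field, the records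
`nonempty_goodReductionAt` (Néron model datum), `nonempty_tateSpecialisation` (`ℓ`-adic specialisation datum) and
`hasGoodReductionAt_of_isUnramifiedAt` (converse Néron–Ogg–Šafarevič) through which A-p04's `shimuraTaniyama_heckeCharacters_of_thm18_6`
derives row II-5; row II-2β is A-p14's theorem `shimura1998_prop26_definedOverQbar_holds`.  Term: A-p01's `H21_of_thm18_6`
(`H21 = shimura1998_thm21_4_casselman` by `rfl`). [cite: Shimura1998, §21.4 Thm. 21.4; Thm. 19.11] [cite: SerreTate1968, §7 Thm. 10–12; §1 Thm. 1] -/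
theorem thm21_4_casselman_of_thm18_6_of_records (h186 : shimura1998_thm18_6)
    (h₁ : ∀ (k : Type) [Field k] [NumberField k] (A₀ : AbelianVariety k) (v : HeightOneSpectrum (𝓞 k)),
      AbelianVariety.nonempty_goodReductionAt A₀ v)
    (h₂ : ∀ (k : Type) [Field k] [NumberField k] (A₀ : AbelianVariety k) (v : HeightOneSpectrum (𝓞 k))
      (R : A₀.GoodReductionAt v) (ℓ : ℕ) [Fact ℓ.Prime], R.nonempty_tateSpecialisation ℓ)
    (h₃ : ∀ (k : Type) [Field k] [NumberField k] (A₀ : AbelianVariety k) (v : HeightOneSpectrum (𝓞 k)),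
      AbelianVariety.hasGoodReductionAt_of_isUnramifiedAt A₀ v) :
    shimura1998_thm21_4_casselman :=
  H21_of_thm18_6 h186 shimura1998_prop26_definedOverQbar_holds h₁ h₂ h₃

/-- **`HCCMUnconditional.H21` — the route item behind the binder `h21` — is a kernel theorem from row II-1 (`shimura1998_thm18_6`,
[Shimura 1998, Thm. 18.6]) and the three reduction-theory records alone**: A-p01's `H21_of_thm18_6` with its hypothesis
`hQbar : shimura1998_prop26_definedOverQbar` DISCHARGED by name (`shimura1998_prop26_definedOverQbar_holds`, A-p14 p608173 — Shimura 1998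
§12.4 Prop. 26 proved by spreading out over a finitely generated `ℚ̄`-domain, specialising at a `ℚ̄`-point, and reading the CM type on the
conormal module of the unit section).  The records `h₁ h₂ h₃` are the binders of `H21_of_thm18_6` verbatim.  HC_CM is proved only
modulo the 7 printed citations until rung 0 closes; this theorem discharges no binder by itself.
[cite: Shimura1998, §21.4 Thm. 21.4; §18.6 Thm. 18.6; §12.4 Prop. 26; Thm. 19.11] [cite: SerreTate1968, §7 Thm. 10–12; §1 Thm. 1] -/
theorem H21_of_thm18_6_of_records (h186 : shimura1998_thm18_6)
    (h₁ : ∀ (k : Type) [Field k] [NumberField k] (A₀ : AbelianVariety k) (v : HeightOneSpectrum (𝓞 k)),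
      AbelianVariety.nonempty_goodReductionAt A₀ v)
    (h₂ : ∀ (k : Type) [Field k] [NumberField k] (A₀ : AbelianVariety k) (v : HeightOneSpectrum (𝓞 k))
      (R : A₀.GoodReductionAt v) (ℓ : ℕ) [Fact ℓ.Prime], R.nonempty_tateSpecialisation ℓ)
    (h₃ : ∀ (k : Type) [Field k] [NumberField k] (A₀ : AbelianVariety k) (v : HeightOneSpectrum (𝓞 k)),
      AbelianVariety.hasGoodReductionAt_of_isUnramifiedAt A₀ v) :
    Summit.HodgeConjecture.HodgeConjecture.Theses.HCCMUnconditional.H21 :=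
  H21_of_thm18_6 h186 shimura1998_prop26_definedOverQbar_holds h₁ h₂ h₃

/-! ## Appendix (appended after p609133): the Casselman core modulo row II-1 alone -/

section Core

open CategoryTheory
open Literature.NumberTheory.GaloisRepresentations
open scoped ComplexConjugate

/-- **The Casselman core (Shimura 1998 Thm. 21.4 verbatim, Frobenius form of «determines `χ`») modulo row II-1 ALONE**: A-p01's
`casselmanCore_of_facts` (p606889 — «there exists a structure `(A₀, ι₀)` of type `(K, Φ)` rational over `k` which determines `χ`»,
(19.10g) read on `ℓ`-power torsion at the good unramified places) with its hypothesis `h26 : shimura1998_prop26_definedOverNumberField`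
DISCHARGED by name (`shimura1998_prop26_definedOverNumberField_holds`, A-p14 p608173).  Statement = `casselmanCore_of_facts`'s conclusion
character for character; term = one application.  This is the honest Frobenius-form content of Thm. 21.4 that the tree proves from the Main
Theorem of CM (`shimura1998_thm18_6`) with no reduction-theory record and no II-5.  HC_CM is proved only modulo the 7 printed citations
until rung 0 closes. [cite: Shimura1998, §21.4 Thm. 21.4 (proof, p. 192); §12.4 Prop. 26; §21.1 Prop. 21.1] -/
theorem casselmanCore_of_thm18_6 (h186 : shimura1998_thm18_6) :
    ∀ (k : Type) [Field k] [NumberField k] [Algebra k ℂ] (K : Type) [Field K] [NumberField K]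
      [IsCMField K] (Φ : CMType K) (τ₀ : K →+* ℂ) (χ : HeckeCharacter k),
    ((traceField Φ : Set ℂ) ⊆ Set.range (algebraMap k ℂ)) →
    χ.HasInfinityType (cmInfinityType Φ.1 τ₀ (algebraMap k ℂ)).1
      (cmInfinityType Φ.1 τ₀ (algebraMap k ℂ)).2 →
    (∀ x : ideleGroup k, (x : AdeleRing (𝓞 k) k).1 = 1 →
      (∃ b : K, ((χ x : ℂˣ) : ℂ) = τ₀ b) ∧
        ((χ x : ℂˣ) : ℂ) * conj ((χ x : ℂˣ) : ℂ) = (((ideleNorm x)⁻¹ : ℝ) : ℂ)) →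
    (∀ (v : HeightOneSpectrum (𝓞 k)) (u : (v.adicCompletionIntegers k)ˣ),
      ∃ b : (𝓞 K)ˣ, ((χ.localComponent v
        (Units.map ((v.adicCompletionIntegers k).subtype : _ →* _) u) : ℂˣ) : ℂ) =
        τ₀ ((b : 𝓞 K) : K)) →
    (∀ v : HeightOneSpectrum (𝓞 k), ∃ π : 𝓞 K, χ.valueAtUniformizer v = τ₀ (π : K) ∧
      ∀ (L : Type) [Field L] [NumberField L] [Normal ℚ L] (ιL : L →+* ℂ) (j : K →+* L)
        (σL : k →+* L), ιL.comp σL = algebraMap k ℂ →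
        IsReflexTypeNorm (valuedIn ιL Φ.1) j σL v.asIdeal (Ideal.span {π})) →
    ∃ (A₀ : AbelianVariety k) (ι₀ : 𝓞 K →+* End A₀),
      IsCMTypeRealisationOver Φ A₀ ι₀ ∧
      ∀ v : HeightOneSpectrum (𝓞 k), χ.IsUnramifiedAt v →
        ∃ π : 𝓞 K, χ.valueAtUniformizer v = τ₀ (π : K) ∧
          ∀ (ℓ : ℕ) [Fact ℓ.Prime], (ℓ : 𝓞 k) ∉ v.asIdeal →
            ∀ 𝔓 ∈ v.primesAbove, ∀ σ : Field.absoluteGaloisGroup k, IsArithFrobAt (𝓞 k) σ 𝔓 →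
              A₀.tateRep ℓ σ = AbelianVariety.tateModuleMap ℓ (ι₀ π : A₀ ⟶ A₀) :=
  casselmanCore_of_facts shimura1998_prop26_definedOverNumberField_holds h186

end Core

end Summit.HodgeConjecture.CorCM.Hyp21
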